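import Summits.AtomisticToContinuum.Crystallization.Theorems.OverbindingBudgetAffineRunCutChiralityMoments
import Summits.AtomisticToContinuum.Crystallization.Theorems.OverbindingBudgetAffineRunCutChiral

/-!
# `OverbindingBudget` / crux `RobustDefectLimitWindows` (stmt-AtomisticToContinuum-31280) — «RunCut»: `κLJ(a)` IS the second-order chirality coefficient

Support file (lens-4 g86, hand-in 3 part 0; memo `g86/memo/SW-G1.md` §9.8–9.9).  The chirality weight of the offset coset at own scale `a` is
`g_a(ij) = 2W″(a²(Q₁(i,j) + 2/3)) = 7a⁻¹⁶·(Q₁+2/3)⁻⁸ − 4a⁻¹⁰·(Q₁+2/3)⁻⁵` (`W(ρ) = V_LJ(√ρ) = ρ⁻⁶/12 − ρ⁻³/6`),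
i.e. `7a⁻¹⁶·layerTerm 1 8 (2/3) − 4a⁻¹⁰·layerTerm 1 5 (2/3)`;
by `…RunCutChiralitySelect.tsum_weight_quadForm_sq_sub` the second-order class-exchange difference is `8h·(Σ' g_a x²y)·F(E)`, `h = a√(2/3)`,
`x = a(2i+j+1)/2`, `y = a(3j+1)/(2√3)`.  THIS FILE proves ★ `kappaLJ_eq_moment`: `8h·Σ' g_a x²y = kappaLJ a` (the certified `κ(a)` of `…RunCutChiral`),
through `Σ' layerTerm 1 (n+2) (2/3)·X²Y = chiSum n / 12` (Part B: the chirality cubic is `C = Y(9X² − Y²)` and `Σ' L·Y³ = −3Σ' L·X²Y` by the threefold axis,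
`…RunCutChiralityMoments.moment_y3`), with the cubic-moment summability against layer terms of exponent `≥ 4` (Part A) that hand-in 3 also needs
for `odd_moments_metric`.  [this file: 0 definitions, 5 theorems; imports `…RunCutChiralityMoments`, `…RunCutChiral`; standard axioms]
-/

namespace Summit.AtomisticToContinuum.Crystallization.Theorems.OverbindingBudgetAffineRunCutChiralityKappa

open Literature.MathematicalPhysics.StatisticalMechanics.StackingSums
open Summit.AtomisticToContinuum.Crystallization.Theorems.OverbindingBudgetAffineRunCutAxial
open Summit.AtomisticToContinuum.Crystallization.Theorems.OverbindingBudgetAffineRunCutChiralityMoments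
open Summit.AtomisticToContinuum.Crystallization.Theorems.OverbindingBudgetAffineRunCutChiral

/-! ## Part A — summability of cubic moments against layer terms of exponent `≥ 4` -/

/-- **Summability, quadratic growth**: a moment with `|P| ≤ (12(Q_δ + s) + 12)²` against `layerTerm δ n s`, `n ≥ 4`, `s ≥ 0`, is summable
(dominated by `144·(layerTerm δ (n−2) s + 2·layerTerm δ (n−1) s + layerTerm δ n s)`). [this file · kind: proof] -/
theorem summable_layerTerm_mul_sq {δ : ℕ} (hδ : δ ≤ 1) {s : ℝ} (hs : 0 ≤ s) {n : ℕ} (hn : 4 ≤ n) (P : ℤ × ℤ → ℝ)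
    (hP : ∀ ij : ℤ × ℤ, |P ij| ≤ (12 * (stackForm δ ij.1 ij.2 + s) + 12) ^ 2) :
    Summable fun ij => layerTerm δ n s ij * P ij := by
  obtain ⟨m, rfl⟩ : ∃ m, n = m + 2 := ⟨n - 2, by omega⟩
  have hg : Summable fun ij =>
      144 * layerTerm δ m s ij + 288 * layerTerm δ (m + 1) s ij + 144 * layerTerm δ (m + 2) s ij :=
    (((layerTerm_summable hδ hs (by omega)).mul_left 144).add ((layerTerm_summable hδ hs (by omega)).mul_left 288)).add
      ((layerTerm_summable hδ hs (by omega)).mul_left 144)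
  refine Summable.of_norm_bounded hg fun ij => ?_
  rw [Real.norm_eq_abs, abs_mul, abs_of_nonneg (layerTerm_nonneg hδ _ hs ij)]
  have hQ : 0 ≤ stackForm δ ij.1 ij.2 + s := by have := stackForm_nonneg hδ ij.1 ij.2; linarith
  have h0 := layerTerm_nonneg hδ m hs ij
  have h1 := layerTerm_nonneg hδ (m + 1) hs ij
  have h2 := layerTerm_nonneg hδ (m + 2) hs ij
  rcases hQ.eq_or_lt with hz | hpos
  · have : layerTerm δ (m + 2) s ij = 0 := by unfold layerTerm; rw [← hz]; simp
    rw [this, zero_mul]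
    positivity
  · have key : ∀ k : ℕ, layerTerm δ k s ij = layerTerm δ (k + 1) s ij * (stackForm δ ij.1 ij.2 + s) := by
      intro k; unfold layerTerm; rw [pow_succ, mul_assoc, inv_mul_cancel₀ hpos.ne', mul_one]
    have e1 : layerTerm δ (m + 1) s ij = layerTerm δ (m + 2) s ij * (stackForm δ ij.1 ij.2 + s) := key (m + 1)
    have e0 : layerTerm δ m s ij = layerTerm δ (m + 2) s ij * (stackForm δ ij.1 ij.2 + s) ^ 2 := by
      rw [key m, key (m + 1)]; ring
    rw [e1, e0]
    nlinarith [mul_le_mul_of_nonneg_left (hP ij) h2]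

/-- **The cubic moments are quadratically bounded** (`δ ≤ 1`, `s ≥ 0`; `X = 2i+j+δ`, `Y = 3j+δ`, `3X² + Y² = 12Q_δ`): `|X²Y|, |Y³|, |X³|, |XY²| ≤ (12(Q+s)+12)²`.
[this file · kind: proof] -/
theorem cubic_moments_le {δ : ℕ} (hδ : δ ≤ 1) {s : ℝ} (hs : 0 ≤ s) (ij : ℤ × ℤ) :
    |(2 * (ij.1 : ℝ) + ij.2 + δ) ^ 2 * (3 * (ij.2 : ℝ) + δ)| ≤ (12 * (stackForm δ ij.1 ij.2 + s) + 12) ^ 2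
      ∧ |(3 * (ij.2 : ℝ) + δ) ^ 3| ≤ (12 * (stackForm δ ij.1 ij.2 + s) + 12) ^ 2
      ∧ |(2 * (ij.1 : ℝ) + ij.2 + δ) ^ 3| ≤ (12 * (stackForm δ ij.1 ij.2 + s) + 12) ^ 2
      ∧ |(2 * (ij.1 : ℝ) + ij.2 + δ) * (3 * (ij.2 : ℝ) + δ) ^ 2| ≤ (12 * (stackForm δ ij.1 ij.2 + s) + 12) ^ 2 := by
  have hQ := twelve_stackForm_eq hδ ij.1 ij.2
  have hQ0 := stackForm_nonneg hδ ij.1 ij.2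
  set X := 2 * (ij.1 : ℝ) + ij.2 + δ with hX
  set Y := 3 * (ij.2 : ℝ) + δ with hY
  set Q := stackForm δ ij.1 ij.2 with hQdef
  have hX2 : X ^ 2 ≤ 4 * (Q + s) := by nlinarith [sq_nonneg Y]
  have hY2 : Y ^ 2 ≤ 12 * (Q + s) := by nlinarith [sq_nonneg X]
  have hXa : |X| ≤ (1 + X ^ 2) / 2 := by
    rw [abs_le]; constructor <;> nlinarith [sq_nonneg (X + 1), sq_nonneg (X - 1)]
  have hYa : |Y| ≤ (1 + Y ^ 2) / 2 := by
    rw [abs_le]; constructor <;> nlinarith [sq_nonneg (Y + 1), sq_nonneg (Y - 1)]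
  have hQs : 0 ≤ Q + s := by linarith
  have habsX := abs_nonneg X
  have habsY := abs_nonneg Y
  refine ⟨?_, ?_, ?_, ?_⟩
  · rw [abs_mul, abs_pow, sq_abs]
    nlinarith [mul_le_mul hX2 hYa habsY (by linarith), mul_nonneg hQs hQs]
  · rw [abs_pow, pow_succ, sq_abs]
    nlinarith [mul_le_mul hY2 hYa habsY (by linarith), mul_nonneg hQs hQs]
  · rw [abs_pow, pow_succ, sq_abs]
    nlinarith [mul_le_mul hX2 hXa habsX (by linarith), mul_nonneg hQs hQs]
  · rw [abs_mul, abs_pow, sq_abs]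
    nlinarith [mul_le_mul hY2 hXa habsX (by linarith), mul_nonneg hQs hQs]

/-- **The six summabilities of `odd_moments_metric`** for a layer-term weight `layerTerm δ n s`, `n ≥ 4` (`δ ≤ 1`, `s ≥ 0`). [this file · kind: proof] -/
theorem layerTerm_moments_summable {δ : ℕ} (hδ : δ ≤ 1) {s : ℝ} (hs : 0 ≤ s) {n : ℕ} (hn : 4 ≤ n) :
    (Summable fun ij : ℤ × ℤ => layerTerm δ n s ij * (2 * (ij.1 : ℝ) + ij.2 + δ))
      ∧ (Summable fun ij : ℤ × ℤ => layerTerm δ n s ij * (3 * (ij.2 : ℝ) + δ))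
      ∧ (Summable fun ij : ℤ × ℤ => layerTerm δ n s ij * (2 * (ij.1 : ℝ) + ij.2 + δ) ^ 3)
      ∧ (Summable fun ij : ℤ × ℤ => layerTerm δ n s ij * ((2 * (ij.1 : ℝ) + ij.2 + δ) * (3 * (ij.2 : ℝ) + δ) ^ 2))
      ∧ (Summable fun ij : ℤ × ℤ => layerTerm δ n s ij * (3 * (ij.2 : ℝ) + δ) ^ 3)
      ∧ (Summable fun ij : ℤ × ℤ => layerTerm δ n s ij * ((2 * (ij.1 : ℝ) + ij.2 + δ) ^ 2 * (3 * (ij.2 : ℝ) + δ))) := by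
  refine ⟨?_, ?_, ?_, ?_, ?_, ?_⟩
  · refine summable_layerTerm_mul hδ hs (by omega) _ fun ij => ?_
    have hQ := twelve_stackForm_eq hδ ij.1 ij.2
    have hQ0 := stackForm_nonneg hδ ij.1 ij.2
    rw [abs_le]; constructor <;> nlinarith [sq_nonneg (2 * (ij.1 : ℝ) + ij.2 + δ + 1), sq_nonneg (2 * (ij.1 : ℝ) + ij.2 + δ - 1),
      sq_nonneg (3 * (ij.2 : ℝ) + δ)]
  · refine summable_layerTerm_mul hδ hs (by omega) _ fun ij => ?_
    have hQ := twelve_stackForm_eq hδ ij.1 ij.2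
    have hQ0 := stackForm_nonneg hδ ij.1 ij.2
    rw [abs_le]; constructor <;> nlinarith [sq_nonneg (3 * (ij.2 : ℝ) + δ + 1), sq_nonneg (3 * (ij.2 : ℝ) + δ - 1),
      sq_nonneg (2 * (ij.1 : ℝ) + ij.2 + δ)]
  · exact summable_layerTerm_mul_sq hδ hs hn _ fun ij => (cubic_moments_le hδ hs ij).2.2.1
  · exact summable_layerTerm_mul_sq hδ hs hn _ fun ij => (cubic_moments_le hδ hs ij).2.2.2
  · exact summable_layerTerm_mul_sq hδ hs hn _ fun ij => (cubic_moments_le hδ hs ij).2.1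
  · exact summable_layerTerm_mul_sq hδ hs hn _ fun ij => (cubic_moments_le hδ hs ij).1

/-! ## Part B — the chirality lattice constant as an `X²Y`-moment -/

/-- **`Σ' layerTerm 1 (n+2) (2/3) · X²Y = chiSum n / 12`** (`n ≥ 2`): the chirality cubic is `C(i,j) = Y(9X² − Y²)` and `Σ' L·Y³ = −3·Σ' L·X²Y`
by the threefold axis. [this file · kind: proof] -/
theorem tsum_layerTerm_X2Y (n : ℕ) (hn : 2 ≤ n) :
    ∑' ij : ℤ × ℤ, layerTerm 1 (n + 2) (2 / 3) ij * ((2 * (ij.1 : ℝ) + ij.2 + 1) ^ 2 * (3 * (ij.2 : ℝ) + 1)) = chiSum n / 12 := by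
  have h23 : (0 : ℝ) ≤ 2 / 3 := by norm_num
  obtain ⟨-, -, -, -, s3, s4⟩ := layerTerm_moments_summable (δ := 1) le_rfl h23 (n := n + 2) (by omega)
  have U := moment_y3 (δ := 1) (layerTerm 1 (n + 2) (2 / 3)) (fun ij => layerTerm_c3Map 1 (n + 2) (2 / 3) ij) s3 s4
  simp only [Nat.cast_one] at U s3 s4
  have e : chiSum n = ∑' ij : ℤ × ℤ, (9 * (layerTerm 1 (n + 2) (2 / 3) ij * ((2 * (ij.1 : ℝ) + ij.2 + 1) ^ 2 * (3 * (ij.2 : ℝ) + 1)))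
      - layerTerm 1 (n + 2) (2 / 3) ij * (3 * (ij.2 : ℝ) + 1) ^ 3) := by
    unfold chiSum
    refine tsum_congr fun ij => ?_
    unfold chiTerm chiCubic
    push_cast
    ring
  rw [e, (s4.mul_left 9).tsum_sub s3, tsum_mul_left, U]
  ring

/-! ## Part C — ★ `κLJ` is the coefficient -/

/-- ★ **`κLJ(a) = 8h·Σ' g_a x²y`** with `g_a = 7a⁻¹⁶·layerTerm 1 8 (2/3) − 4a⁻¹⁰·layerTerm 1 5 (2/3)` (`= 2W″(|r|²)` on the offset coset), `h = a√(2/3)`,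
`x = a(2i+j+1)/2`, `y = a(3j+1)/(2√3)` — the certified chirality coefficient of `…RunCutChiral` is exactly the second-order constant that
`…RunCutChiralitySelect.tsum_weight_quadForm_sq_sub` produces. [this file · kind: proof] -/
theorem kappaLJ_eq_moment {a : ℝ} (ha : a ≠ 0) :
    8 * (a * Real.sqrt (2 / 3)) *
        ∑' ij : ℤ × ℤ, (7 * (a⁻¹) ^ 16 * layerTerm 1 8 (2 / 3) ij - 4 * (a⁻¹) ^ 10 * layerTerm 1 5 (2 / 3) ij)
          * ((a * (2 * (ij.1 : ℝ) + ij.2 + 1) / 2) ^ 2 * (a * (3 * (ij.2 : ℝ) + 1) / (2 * Real.sqrt 3)))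
      = kappaLJ a := by
  have h3 : (0 : ℝ) < Real.sqrt 3 := Real.sqrt_pos.2 (by norm_num)
  have hsq3 : Real.sqrt 3 ^ 2 = 3 := Real.sq_sqrt (by norm_num)
  have h23 : Real.sqrt (2 / 3) = Real.sqrt 2 / Real.sqrt 3 := Real.sqrt_div (by norm_num) 3
  have h23' : (0 : ℝ) ≤ 2 / 3 := by norm_num
  obtain ⟨-, -, -, -, -, s8⟩ := layerTerm_moments_summable (δ := 1) le_rfl h23' (n := 8) (by omega)
  obtain ⟨-, -, -, -, -, s5⟩ := layerTerm_moments_summable (δ := 1) le_rfl h23' (n := 5) (by omega)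
  simp only [Nat.cast_one] at s8 s5
  have S8 := tsum_layerTerm_X2Y 6 (by omega)
  have S5 := tsum_layerTerm_X2Y 3 (by omega)
  have e : ∀ ij : ℤ × ℤ, (7 * (a⁻¹) ^ 16 * layerTerm 1 8 (2 / 3) ij - 4 * (a⁻¹) ^ 10 * layerTerm 1 5 (2 / 3) ij)
        * ((a * (2 * (ij.1 : ℝ) + ij.2 + 1) / 2) ^ 2 * (a * (3 * (ij.2 : ℝ) + 1) / (2 * Real.sqrt 3)))
      = (a ^ 3 / (8 * Real.sqrt 3)) *
          (7 * (a⁻¹) ^ 16 * (layerTerm 1 8 (2 / 3) ij * ((2 * (ij.1 : ℝ) + ij.2 + 1) ^ 2 * (3 * (ij.2 : ℝ) + 1)))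
            - 4 * (a⁻¹) ^ 10 * (layerTerm 1 5 (2 / 3) ij * ((2 * (ij.1 : ℝ) + ij.2 + 1) ^ 2 * (3 * (ij.2 : ℝ) + 1)))) := by
    intro ij
    field_simp
    ring
  rw [tsum_congr e, tsum_mul_left, (s8.mul_left (7 * (a⁻¹) ^ 16)).tsum_sub (s5.mul_left (4 * (a⁻¹) ^ 10)),
    tsum_mul_left, tsum_mul_left]
  rw [show (6 : ℕ) + 2 = 8 from rfl] at S8
  rw [show (3 : ℕ) + 2 = 5 from rfl] at S5
  rw [S8, S5, h23]
  unfold kappaLJ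
  field_simp
  rw [hsq3]
  ring

end Summit.AtomisticToContinuum.Crystallization.Theorems.OverbindingBudgetAffineRunCutChiralityKappa
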